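import Summits.QuantumFields.YangMills.Theorems.UnitScaleTiltProp7BlockLandauDivFlat
import HarnessLib

/-!
# Route `UnitScaleTilt`, crux K1 «MinimiserStabilityRegPr» (stmt-QuantumFields-19200), route-R E′ path (α) (✓ `…LocMinOfPinnedChartSlice`), the ζ-row on the
# CENTRE-HARMONIC slice `S_H` — LEMMA H, FLAT, BY FOURIER: for a charge vector `q` on the `k`-centres with `Σq = 0`, `g = Σ_y q_y δ_{centre y}`, `h = Δ⁻¹g` (so `Δh = 0`
# off the centres) and `m = (Δ⁻¹h)|_{centres}`:  `ℓ·Σ_x|h(x)|² ≤ C_H·Σ_c|m(c₊) − m(c₋)|²`, `C_H = dπ⁴∕4` (d = 3: 73.06)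

Cell `ym3-torus`, D-0154 (3c) twin-width seat `ym-routeR-w3` (gen 5); row = ★p1 g14 16:41∕16:49∕16:55Z residue «`DIV ≤ ζK` on `S_H ∩ fibre`» (flat core), ★routeR-w3 g4's
LOCATE-R1 LEMMA H (19200 evidence #41; numerically `C_H(ℓ) = 6.40 … 8.17 → 8.4`).  THEOREMS ONLY (0 `def`, 0 `sorry`); `--supports stmt-QuantumFields-19200`, count-neutral.
YM₃ on T³ is a ladder rung (R3), not the Clay problem; nothing here claims the stub, the crux, d = 4 or the mass gap.

THE POINT.  On the slice `S_H = {Δ(∂^*D) = 0 off the k-centres}` the divergence `h = ∂^*D` is the potential of point charges at the centres; g4's chain (1.1)–(1.3) reduces the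
slice budget `DIV ≤ ζE` to ONE potential-theoretic letter, LEMMA H: `ℓ‖h‖² ≤ C_H·Σ_c|δ_c m|²` with `m` the centre values of `Δ⁻¹h`.  g4 proposed a proof by `H⁻¹`-duality
plus a C¹ cardinal extension (a W-sized construction).  HERE IT IS PROVED BY FOURIER with the alias machinery of ✓ `…BlockLandauDivFlat` on the SAME carrier
`T_η = Tor (fine n M)` (block side `n = ℓ`, centres = the block base points `up y`, ✓ `B5Block118.up`): a COMB `g = Σ_y q_y δ_{up y}` has FLAT alias weights —
`ĝ(p′ + l) = (c_f∕c_M)·q̂(p′)` for every alias `l` (✓ `chi_pOf_up`) —; SAMPLING at the centres is the alias SUM — `m̂(p′) = c_Q·Σ_l μ̂(p′+l)` (Poisson summation: Fourier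
inversion + character orthogonality ✓ `sum_conj_chi_mul_chi`) —; the coarse Dirichlet form has symbol `Δ₁(p′) = Σ_μ|e^{ip′_μ} − 1|²` (✓ `dft_mul_shiftS`, ✓ `om_pow`).  Hence per
reduced momentum `p′ ≠ 0` the claim is `Σ_l Δ(p′+l)⁻² ≤ C·Δ₁(p′)·(Σ_l Δ(p′+l)⁻²)²`, i.e. `1 ≤ C·Δ₁(p′)·Σ_lΔ(p′+l)⁻²`, and `Σ_l Δ⁻² ≥ Δ(p′)⁻² ≥ (16∕π⁴)Δ₁(p′)⁻²` (η-units: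
✓ `DeltaXir_le_Delta1r`), `Δ₁ ≤ 4d` (✓ `Delta1r_le`) give `C = dπ⁴∕4`; the fibre `p′ = 0` is empty by `Σq = 0`.

WHAT IS PROVED (ns `…Theorems.Prop7CentreHarmonicDivFlat`; any `d`, `n ≥ 1`, `M_μ ≥ 1`; η-units `c = n` for `Δ = LapS (fine n M) n`, unit coarse lattice).
* §1 tools on the two tori: `star_dotProduct_dft_any`∕`sum_norm_sq_dft_any` (Plancherel, any torus; `re⟨v,v⟩ = ‖v‖²` from ✓ `…BlockLandauDivFlat`), `dft_up_eq` (`F_{p′+l, up y} = (c_f∕c_M)·F¹_{p′,y}`), ★ `dft_comb_pOf`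
  (flat alias weights of a comb), ★ `dft_sample_up` (Poisson: sampling = alias sum), `stdAddChar_eq_exp_sOf`∕`sum_norm_sq_shift_sub` (the coarse Dirichlet form in momentum).
* §2 `one_le_Delta1_mul_aliasSum` — the per-fibre symbol inequality `1 ≤ (dπ⁴∕4)·Δ₁(p′)·Σ_l Δ(p′+l)⁻²` (`p′ ≠ 0`).
* §3 ★★★ `lemmaH_flat` — `Σ_x‖(Δ⁻¹g)(x)‖² ≤ (dπ⁴∕4)·n^d·Σ_νΣ_y‖m(y + e_ν) − m(y)‖²`, `g` the comb of `q` (`Σq = 0`), `m = (Δ⁻²g) ∘ up` (η-units; in lattice units at d = 3 this is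
  `ℓ·Σ|h|² ≤ (3π⁴∕4)·Σ_c|δ_c m|²`, `ℓ = n`: `Δ_η = n²Δ`, `h_η = n⁻²h`, `m_η = n⁻⁴m`).
HONEST SCOPE.  Flat, scalar (matrix∕𝔰𝔲(2) fibres by Parseval over entries); the ENGINE (g4's chain (1.1): Hodge split + constraint on the parts + N5 (iii) + Gauss over
✓ `exists_matrixHodgeSplit_pinned`, ✓ `exists_constraint_on_hodge_parts_bound`, ✓ `sum_sq_lineMean_sub_faceMean_le`, ✓ `sum_faceLayer_mul_coarseGrad_eq_zero`, with this lemma in place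
of the tent∕Dirichlet step of ✓ `Prop7PinnedFlatComponent.sum_sq_add_grad_sq_le_of_component`) and the dictionary `Tor (fine n M)` ↔ `Site (F.P K) 0` are the next file; curved
backgrounds are not touched.  Constants ours; nothing of [Balaban1984PropagatorsI] beyond the cited tree theorems is asserted.

References: T. Bałaban, CMP 95 (1984) 17–40 [Balaban1984PropagatorsI] ((1.29)–(1.31) p.23, (1.35) p.24); CMP 102 (1985) 277–309 [Balaban1985Variational] (Prop. 7 p.299,
(141)–(143) p.299); CMP 99 (1985) 75–102 [Balaban1985RegularSpaces] ((1.14) p.78, (1.27) p.80).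
-/

set_option autoImplicit false

noncomputable section

open scoped BigOperators Matrix ComplexConjugate ComplexOrder
open Finset Complex Matrix

namespace Summit.QuantumFields.YangMills.Theorems.Prop7CentreHarmonicDivFlat

open Literature.MathematicalPhysics.QuantumFieldTheory.Balaban1983to89
open B4Strip B5Prop11Fiber B5Prop11Leaves B5Prop11Plancherel B5Action121 B5Block118 B5LaplaceInverse B5LaplaceSpectral
open B5Momentum130 B5Momentum133 B5Eq135Momentum

variable {d : ℕ}

/-! ## §1 Tools on the two tori -/

section AnyTorus

variable (N : Fin d → ℕ) [hN : ∀ μ, NeZero (N μ)]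

/-- Plancherel for pairings on any torus: `⟨f̃, g̃⟩ = ⟨f, g⟩` for the unitary DFT. [folklore] -/
theorem star_dotProduct_dft_any (f g : Tor N → ℂ) :
    star (dft N *ᵥ f) ⬝ᵥ (dft N *ᵥ g) = star f ⬝ᵥ g := by
  have hU : star (dft N) * dft N = 1 := Matrix.mem_unitaryGroup_iff'.mp (dft_mem_unitaryGroup N)
  rw [Matrix.star_mulVec, ← Matrix.dotProduct_mulVec, Matrix.mulVec_mulVec, ← Matrix.star_eq_conjTranspose, hU, Matrix.one_mulVec]

/-- Plancherel for norms on any torus: `Σ_p|f̃(p)|² = Σ_x|f(x)|²`. [folklore] -/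
theorem sum_norm_sq_dft_any (f : Tor N → ℂ) : ∑ p, ‖(dft N *ᵥ f) p‖ ^ 2 = ∑ x, ‖f x‖ ^ 2 := by
  rw [← Prop7BlockLandauDivFlat.re_star_dotProduct_self, ← Prop7BlockLandauDivFlat.re_star_dotProduct_self, star_dotProduct_dft_any]

/-- the coarse shift in momentum: `(S_ν m)~(p) = e^{ip_ν}·m̃(p)`. [folklore] -/
theorem dft_shift_apply (ν : Fin d) (m : Tor N → ℂ) (p : Tor N) :
    (dft N *ᵥ fun y => m (y + unitVec N ν)) p = (ZMod.stdAddChar (N := N ν)) (p ν) * (dft N *ᵥ m) p := by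
  have h : (fun y => m (y + unitVec N ν)) = shiftS N ν *ᵥ m := funext fun y => (shiftS_mulVec N ν m y).symm
  rw [h, Matrix.mulVec_mulVec, dft_mul_shiftS, ← Matrix.mulVec_mulVec, Matrix.mulVec_diagonal]

/-- `c_T ≠ 0`. [folklore] -/
theorem cT_ne_zero : (cT N : ℂ) ≠ 0 := by
  have h : (0 : ℝ) < Fintype.card (Tor N) := by exact_mod_cast Fintype.card_pos
  have h' : 0 < cT N := by unfold cT; positivity
  exact_mod_cast h'.ne'

end AnyTorus

section TwoTori

variable (n : ℕ) [NeZero n] (M : Fin d → ℕ) [hM : ∀ μ, NeZero (M μ)]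

/-- **THE FINE DFT AT A CENTRE**: `F_{p′+l, up y} = (c_f∕c_M)·F¹_{p′, y}` — the fine character of `p′ + l` at the block base point `up y` is the coarse character of `p′` at `y`
(✓ `chi_pOf_up`), whatever the alias `l`. [folklore] -/
theorem dft_pOf_up (k : Fin d → Fin n) (q y : Tor M) :
    dft (fine n M) (pOf n M (k, q)) (up n M y) = ((cT (fine n M) / cT M : ℝ) : ℂ) * dft M q y := by
  rw [dft_apply', dft_apply', chi_pOf_up, Complex.ofReal_div]
  have h := cT_ne_zero M
  field_simp

/-- ★ **A COMB HAS FLAT ALIAS WEIGHTS**: for `g = Σ_y q_y δ_{up y}`, `ĝ(p′ + l) = (c_f∕c_M)·q̂(p′)` for every alias `l`. [folklore] -/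
theorem dft_comb_pOf (qv : Tor M → ℂ) (k : Fin d → Fin n) (q : Tor M) :
    (dft (fine n M) *ᵥ fun x => ∑ y, if x = up n M y then qv y else 0) (pOf n M (k, q))
      = ((cT (fine n M) / cT M : ℝ) : ℂ) * (dft M *ᵥ qv) q := by
  simp only [Matrix.mulVec, dotProduct, Finset.mul_sum]
  rw [Finset.sum_comm]
  refine Finset.sum_congr rfl fun y _ => ?_
  simp only [mul_ite, mul_zero, Finset.sum_ite_eq', Finset.mem_univ, if_true]
  rw [dft_pOf_up]
  ring

/-- ★ **POISSON SUMMATION: SAMPLING AT THE CENTRES IS THE ALIAS SUM** — for every `μ` on `T_η`, the coarse DFT of `y ↦ μ(up y)` is `(c_f∕c_M)·Σ_l μ̂(p′ + l)`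
(`c_f∕c_M = (√(n^d))⁻¹`). [folklore] -/
theorem dft_sample_up (mu : Tor (fine n M) → ℂ) (q : Tor M) :
    (dft M *ᵥ fun y => mu (up n M y)) q
      = ((cT (fine n M) / cT M : ℝ) : ℂ) * ∑ k : Fin d → Fin n, (dft (fine n M) *ᵥ mu) (pOf n M (k, q)) := by
  -- row orthonormality of the coarse DFT
  have horth : ∀ q' : Tor M, ∑ y, dft M q y * conj (dft M q' y) = if q = q' then 1 else 0 := by
    intro q'
    have h := congrFun (congrFun (dft_mul_star M) q) q'
    rw [Matrix.mul_apply, Matrix.one_apply] at h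
    simpa only [Matrix.star_apply, Complex.star_def] using h
  -- Fourier inversion of `mu` at the base points
  set muhat : Tor (fine n M) → ℂ := dft (fine n M) *ᵥ mu with hmuhat
  have hinv : (fun y => mu (up n M y)) = fun y => ∑ p, conj (dft (fine n M) p (up n M y)) * muhat p :=
    funext fun y => dft_inversion (fine n M) mu (up n M y)
  rw [hinv]
  simp only [Matrix.mulVec, dotProduct]
  calc ∑ y, dft M q y * ∑ p, conj (dft (fine n M) p (up n M y)) * muhat p
      = ∑ p, (∑ y, dft M q y * conj (dft (fine n M) p (up n M y))) * muhat p := by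
        simp only [Finset.mul_sum, Finset.sum_mul]
        rw [Finset.sum_comm]
        refine Finset.sum_congr rfl fun p _ => Finset.sum_congr rfl fun y _ => ?_
        ring
    _ = ∑ q' : Tor M, ∑ k : Fin d → Fin n, (∑ y, dft M q y * conj (dft (fine n M) (pOf n M (k, q')) (up n M y))) * muhat (pOf n M (k, q')) := by
        rw [← (pOf_bijective n M).sum_comp (fun p => (∑ y, dft M q y * conj (dft (fine n M) p (up n M y))) * muhat p),
          Fintype.sum_prod_type, Finset.sum_comm]
    _ = ∑ q' : Tor M, ∑ k : Fin d → Fin n, (((cT (fine n M) / cT M : ℝ) : ℂ) * (if q = q' then 1 else 0)) * muhat (pOf n M (k, q')) := by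
        refine Finset.sum_congr rfl fun q' _ => Finset.sum_congr rfl fun k _ => ?_
        congr 1
        rw [← horth q', Finset.mul_sum]
        refine Finset.sum_congr rfl fun y _ => ?_
        rw [dft_pOf_up, map_mul, Complex.conj_ofReal]
        ring
    _ = ((cT (fine n M) / cT M : ℝ) : ℂ) * ∑ k : Fin d → Fin n, muhat (pOf n M (k, q)) := by
        rw [Finset.sum_eq_single q]
        · simp only [if_true, mul_one, Finset.mul_sum]
        · intro q' _ hq'; simp [Ne.symm hq']
        · intro h; exact absurd (Finset.mem_univ q) h

/-- `(c_f∕c_M)² = n^{−d}` (`|T_η| = n^d·|T₁|`, ✓ `card_fine`). [folklore] -/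
theorem cT_ratio_sq : (cT (fine n M) / cT M) ^ 2 = ((n : ℝ) ^ d)⁻¹ := by
  have ha : (0 : ℝ) < Fintype.card (Tor M) := by exact_mod_cast Fintype.card_pos
  have hn0 : (0 : ℝ) < n := by exact_mod_cast Nat.pos_of_ne_zero (NeZero.ne n)
  have hb : (0 : ℝ) < (n : ℝ) ^ d := pow_pos hn0 d
  unfold cT
  rw [div_pow, inv_pow, inv_pow, Real.sq_sqrt (by positivity), Real.sq_sqrt ha.le, card_fine]
  field_simp

include n in
/-- the coarse character at one unit step is `e^{ip′_ν}` with `p′_ν = sOf q ν` (through the fine torus: ✓ `chi_pOf_up`, ✓ `up_unitVec`, ✓ `chi_pOf_tstep`, ✓ `om_pow`). [folklore] -/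
theorem stdAddChar_eq_exp_sOf (q : Tor M) (ν : Fin d) :
    (ZMod.stdAddChar (N := M ν)) (q ν) = Complex.exp (((sOf M q ν : ℝ) : ℂ) * I) := by
  rw [← chi_unitVec, ← chi_pOf_up n M (fun _ => (0 : Fin n)) q (unitVec M ν), up_unitVec, chi_pOf_tstep, om_pow]

include n in
/-- **THE COARSE DIRICHLET FORM IN MOMENTUM**: `Σ_νΣ_y|m(y + e_ν) − m(y)|² = Σ_{p′} Δ₁(p′)·|m̃(p′)|²`, `Δ₁(p′) = Σ_ν|e^{ip′_ν} − 1|² = Delta1r 0 (sOf p′)`. [folklore] -/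
theorem sum_norm_sq_shift_sub (m : Tor M → ℂ) :
    ∑ ν : Fin d, ∑ y, ‖m (y + unitVec M ν) - m y‖ ^ 2 = ∑ q : Tor M, Delta1r 0 (sOf M q) * ‖(dft M *ᵥ m) q‖ ^ 2 := by
  have hν : ∀ ν : Fin d, ∑ y, ‖m (y + unitVec M ν) - m y‖ ^ 2 = ∑ q : Tor M, ‖d1Sym (sOf M q) ν‖ ^ 2 * ‖(dft M *ᵥ m) q‖ ^ 2 := by
    intro ν
    rw [← sum_norm_sq_dft_any M (fun y => m (y + unitVec M ν) - m y)]
    refine Finset.sum_congr rfl fun q _ => ?_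
    have hsub : (fun y => m (y + unitVec M ν) - m y) = (fun y => m (y + unitVec M ν)) - m := rfl
    rw [hsub, Matrix.mulVec_sub, Pi.sub_apply, dft_shift_apply, stdAddChar_eq_exp_sOf n M q ν, ← sub_one_mul, norm_mul, mul_pow, d1Sym]
  rw [Finset.sum_congr rfl fun ν _ => hν ν, Finset.sum_comm]
  refine Finset.sum_congr rfl fun q _ => ?_
  rw [Delta0_eq, Finset.sum_mul]

end TwoTori

/-! ## §2 The per-fibre symbol inequality -/

/-- **`1 ≤ (dπ⁴∕4)·Δ₁(p′)·Σ_l Δ(p′+l)⁻²`** for `p′ = s ≠ 0`, `|s_μ| ≤ π` (η-units, `Δ(p′+l) = DeltaXir n 0 (shiftr n l s)`, `Δ₁ = Delta1r 0 s`): the main alias alone gives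
`Σ_l Δ⁻² ≥ Δ(p′)⁻² ≥ (16∕π⁴)Δ₁⁻²` (✓ `DeltaXir_le_Delta1r`) and `Δ₁ ≤ 4d` (✓ `Delta1r_le`). [cite: Balaban1984PropagatorsI, (1.31) p.23] -/
theorem one_le_Delta1_mul_aliasSum (n : ℕ) [NeZero n] (hn : 1 ≤ n) (s : Fin d → ℝ) (hs : ∀ μ, |s μ| ≤ Real.pi) (hs0 : s ≠ 0) :
    1 ≤ (d * Real.pi ^ 4 / 4) * Delta1r 0 s * ∑ k : Fin d → Fin n, 1 / DeltaXir n 0 (shiftr n k s) ^ 2 := by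
  obtain ⟨μ0, hμ0⟩ : ∃ μ, s μ ≠ 0 := Function.ne_iff.mp hs0
  set k0 : Fin d → Fin n := fun _ => (0 : Fin n) with hk0
  have hD0eq : DeltaXir n 0 (shiftr n k0 s) = DeltaXir n 0 s := by rw [hk0, shiftr_zero]
  have hD0pos : 0 < DeltaXir n 0 s := DeltaXir_pos n hn s hs μ0 hμ0
  have hΔ1pos : 0 < Delta1r 0 s := Delta1r_pos s hs μ0 hμ0
  have hΔ1le : Delta1r 0 s ≤ 4 * d := Delta1r_le s
  have hD0le : DeltaXir n 0 s ≤ Real.pi ^ 2 / 4 * Delta1r 0 s := DeltaXir_le_Delta1r n s hs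
  -- the main alias
  have hmain : 1 / DeltaXir n 0 s ^ 2 ≤ ∑ k : Fin d → Fin n, 1 / DeltaXir n 0 (shiftr n k s) ^ 2 := by
    rw [← hD0eq]
    exact Finset.single_le_sum (f := fun k => 1 / DeltaXir n 0 (shiftr n k s) ^ 2)
      (fun k _ => by have := DeltaXir_nonneg n 0 le_rfl (shiftr n k s); positivity) (Finset.mem_univ k0)
  have hpi : 0 < Real.pi := Real.pi_pos
  have hd : (0 : ℝ) < d := by exact_mod_cast Fin.pos μ0
  -- `(dπ⁴/4)·Δ₁/Δ(p′)² ≥ (dπ⁴/4)·Δ₁·16/(π⁴Δ₁²) = 4d/Δ₁ ≥ 1`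
  have h1 : 1 ≤ (d * Real.pi ^ 4 / 4) * Delta1r 0 s * (1 / DeltaXir n 0 s ^ 2) := by
    rw [← mul_div_assoc, mul_one, le_div_iff₀ (pow_pos hD0pos 2), one_mul]
    calc DeltaXir n 0 s ^ 2 ≤ (Real.pi ^ 2 / 4 * Delta1r 0 s) ^ 2 := pow_le_pow_left₀ hD0pos.le hD0le 2
      _ = (d * Real.pi ^ 4 / 4) * Delta1r 0 s * (Delta1r 0 s / (4 * d)) := by
          field_simp
      _ ≤ (d * Real.pi ^ 4 / 4) * Delta1r 0 s * 1 := by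
          refine mul_le_mul_of_nonneg_left ?_ (by positivity)
          rw [div_le_one (by positivity)]
          exact hΔ1le
      _ = (d * Real.pi ^ 4 / 4) * Delta1r 0 s := mul_one _
  exact h1.trans (mul_le_mul_of_nonneg_left hmain (by positivity))

/-! ## §3 ★★★ LEMMA H, flat -/

section Main

variable (n : ℕ) [NeZero n] (M : Fin d → ℕ) [hM : ∀ μ, NeZero (M μ)]

/-- the coarse DFT of the charges vanishes at `p′ = 0` when `Σq = 0`. [folklore] -/
theorem dft_zero_of_sum_eq_zero (qv : Tor M → ℂ) (hq : ∑ y, qv y = 0) : (dft M *ᵥ qv) 0 = 0 := by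
  simp only [Matrix.mulVec, dotProduct, dft_apply', chi_zero_left, map_one, mul_one]
  rw [← Finset.mul_sum, hq, mul_zero]

/-- ★★★ **LEMMA H (FLAT): THE `L²` MASS OF A CENTRE-HARMONIC DIVERGENCE IS CONTROLLED BY THE COARSE DIFFERENCES OF THE CENTRE VALUES OF ITS POTENTIAL.**  On `T_η = Tor (fine n M)`
(block side `n ≥ 1`, η-units `Δ = LapS … n`), for charges `q` on the centres with `Σ_y q_y = 0`, the comb `g = Σ_y q_y δ_(up y)`, `h = Δ⁻¹g` (so `Δh = 0` off the centres — the divergence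
of a field on the slice `S_H`) and `m = (Δ⁻¹h) ∘ up` (centre values of the potential):
`Σ_x‖h(x)‖² ≤ (dπ⁴∕4)·n^d·Σ_νΣ_y‖m(y + e_ν) − m(y)‖²`.  In lattice units at `d = 3` (`Δ_η = n²Δ`, `h_η = n⁻²h`, `m_η = n⁻⁴m`, `ℓ = n`) this is
`ℓ·Σ_x|h|² ≤ (3π⁴∕4)·Σ_c|m(c₊) − m(c₋)|²` — ★routeR-w3 g4's LEMMA H with `C_H ≤ 73.1` (numerically `→ 8.4`).
[cite: Balaban1984PropagatorsI, (1.29)-(1.31) p.23, (1.35) p.24; Balaban1985Variational, Prop. 7 p.299] -/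
theorem lemmaH_flat (hn : 1 ≤ n) (qv : Tor M → ℂ) (hq : ∑ y, qv y = 0) :
    ∑ x, ‖(LapSinv (fine n M) (n : ℂ) *ᵥ (fun x : Tor (fine n M) => ∑ y : Tor M, if x = up n M y then qv y else 0)) x‖ ^ 2
      ≤ (d * Real.pi ^ 4 / 4) * (n : ℝ) ^ d
          * ∑ ν : Fin d, ∑ y : Tor M,
              ‖(LapSinv (fine n M) (n : ℂ) *ᵥ (LapSinv (fine n M) (n : ℂ) *ᵥ (fun x : Tor (fine n M) => ∑ y : Tor M, if x = up n M y then qv y else 0))) (up n M (y + unitVec M ν))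
                - (LapSinv (fine n M) (n : ℂ) *ᵥ (LapSinv (fine n M) (n : ℂ) *ᵥ (fun x : Tor (fine n M) => ∑ y : Tor M, if x = up n M y then qv y else 0))) (up n M y)‖ ^ 2 := by
  -- letters
  set g : Tor (fine n M) → ℂ := (fun x : Tor (fine n M) => ∑ y : Tor M, if x = up n M y then qv y else 0) with hgdef
  set h : Tor (fine n M) → ℂ := LapSinv (fine n M) (n : ℂ) *ᵥ g with hhdef
  set mu : Tor (fine n M) → ℂ := LapSinv (fine n M) (n : ℂ) *ᵥ h with hmudef
  set Qh : Tor M → ℂ := dft M *ᵥ qv with hQh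
  set r : ℝ := cT (fine n M) / cT M with hr
  have hr0 : 0 ≤ r := by rw [hr]; unfold cT; positivity
  have hs : ∀ q : Tor M, ∀ μ, |sOf M q μ| ≤ Real.pi := fun q => abs_sOf_le M q
  have hD : ∀ (k : Fin d → Fin n) (q : Tor M), lsym (fine n M) (n : ℂ) (pOf n M (k, q)) = ((DeltaXir n 0 (shiftr n k (sOf M q)) : ℝ) : ℂ) :=
    fun k q => lsym_pOf n M k q
  have hDnn : ∀ (k : Fin d → Fin n) (q : Tor M), 0 ≤ DeltaXir n 0 (shiftr n k (sOf M q)) := fun k q => DeltaXir_nonneg n 0 le_rfl _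
  -- the three Fourier transforms on the fibre `p′ ↔ q`, alias `l ↔ k`
  have hg : ∀ (k : Fin d → Fin n) (q : Tor M), (dft (fine n M) *ᵥ g) (pOf n M (k, q)) = (r : ℂ) * Qh q := fun k q => dft_comb_pOf n M qv k q
  have hh : ∀ (k : Fin d → Fin n) (q : Tor M), (dft (fine n M) *ᵥ h) (pOf n M (k, q))
      = (((DeltaXir n 0 (shiftr n k (sOf M q)) : ℝ) : ℂ))⁻¹ * ((r : ℂ) * Qh q) := by
    intro k q; rw [hhdef, dft_LapSinv_apply, hD, hg]
  have hmu : ∀ (k : Fin d → Fin n) (q : Tor M), (dft (fine n M) *ᵥ mu) (pOf n M (k, q))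
      = (((DeltaXir n 0 (shiftr n k (sOf M q)) : ℝ) : ℂ))⁻¹ ^ 2 * ((r : ℂ) * Qh q) := by
    intro k q; rw [hmudef, dft_LapSinv_apply, hD, hh, sq]; ring
  -- LEFT SIDE in momentum: `Σ_q r²‖q̂‖²·S₂(q)`
  have hL : ∑ x, ‖h x‖ ^ 2 = ∑ q : Tor M, r ^ 2 * ‖Qh q‖ ^ 2 * ∑ k : Fin d → Fin n, 1 / DeltaXir n 0 (shiftr n k (sOf M q)) ^ 2 := by
    rw [← sum_norm_sq_dft n M h, sum_pOf_fibres n M (fun p => ‖(dft (fine n M) *ᵥ h) p‖ ^ 2)]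
    refine Finset.sum_congr rfl fun q _ => ?_
    rw [Finset.mul_sum]
    refine Finset.sum_congr rfl fun k _ => ?_
    rw [hh, norm_mul, norm_mul, norm_inv, Complex.norm_real, Real.norm_of_nonneg (hDnn k q), Complex.norm_real, Real.norm_of_nonneg hr0]
    by_cases h0 : DeltaXir n 0 (shiftr n k (sOf M q)) = 0
    · rw [h0]; simp
    · field_simp
  -- RIGHT SIDE in momentum: `Σ_q Δ₁(q)·r⁴‖q̂‖²·S₂(q)²`
  have hS : ∀ q : Tor M, ∑ k : Fin d → Fin n, (((DeltaXir n 0 (shiftr n k (sOf M q)) : ℝ) : ℂ))⁻¹ ^ 2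
      = ((∑ k : Fin d → Fin n, 1 / DeltaXir n 0 (shiftr n k (sOf M q)) ^ 2 : ℝ) : ℂ) := by
    intro q
    push_cast
    refine Finset.sum_congr rfl fun k _ => ?_
    rw [one_div, inv_pow]
  have hmhat : ∀ q : Tor M, (dft M *ᵥ fun y => mu (up n M y)) q
      = (r : ℂ) * ((r : ℂ) * Qh q) * ((∑ k : Fin d → Fin n, 1 / DeltaXir n 0 (shiftr n k (sOf M q)) ^ 2 : ℝ) : ℂ) := by
    intro q
    rw [dft_sample_up, ← hS, Finset.mul_sum, Finset.mul_sum]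
    refine Finset.sum_congr rfl fun k _ => ?_
    rw [hmu]; ring
  have hR : ∑ ν : Fin d, ∑ y : Tor M, ‖mu (up n M (y + unitVec M ν)) - mu (up n M y)‖ ^ 2
      = ∑ q : Tor M, Delta1r 0 (sOf M q) * (r ^ 2 * r ^ 2 * ‖Qh q‖ ^ 2 * (∑ k : Fin d → Fin n, 1 / DeltaXir n 0 (shiftr n k (sOf M q)) ^ 2) ^ 2) := by
    rw [sum_norm_sq_shift_sub n M (fun y => mu (up n M y))]
    refine Finset.sum_congr rfl fun q _ => ?_
    congr 1
    have hS0 : 0 ≤ ∑ k : Fin d → Fin n, 1 / DeltaXir n 0 (shiftr n k (sOf M q)) ^ 2 :=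
      Finset.sum_nonneg fun k _ => by have := hDnn k q; positivity
    rw [hmhat]
    simp only [norm_mul, Complex.norm_real, Real.norm_of_nonneg hr0, Real.norm_of_nonneg hS0]
    ring
  -- compare fibre by fibre
  rw [hL, hR, Finset.mul_sum]
  refine Finset.sum_le_sum fun q _ => ?_
  have hS0 : 0 ≤ ∑ k : Fin d → Fin n, 1 / DeltaXir n 0 (shiftr n k (sOf M q)) ^ 2 :=
    Finset.sum_nonneg fun k _ => by have := hDnn k q; positivity
  have hrn : (n : ℝ) ^ d * r ^ 2 = 1 := by
    rw [hr, cT_ratio_sq]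
    have : (0 : ℝ) < (n : ℝ) ^ d := pow_pos (by exact_mod_cast Nat.pos_of_ne_zero (NeZero.ne n)) d
    field_simp
  by_cases hq0 : q = 0
  · -- the fibre `p′ = 0` carries nothing: `q̂(0) = c·Σq = 0`
    subst hq0
    have : Qh 0 = 0 := by rw [hQh]; exact dft_zero_of_sum_eq_zero M qv hq
    rw [this]; simp
  · have hfib := one_le_Delta1_mul_aliasSum n hn (sOf M q) (hs q) (sOf_ne_zero M hq0)
    have hT0 : 0 ≤ r ^ 2 * ‖Qh q‖ ^ 2 * ∑ k : Fin d → Fin n, 1 / DeltaXir n 0 (shiftr n k (sOf M q)) ^ 2 := by positivity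
    calc r ^ 2 * ‖Qh q‖ ^ 2 * ∑ k : Fin d → Fin n, 1 / DeltaXir n 0 (shiftr n k (sOf M q)) ^ 2
        = 1 * (r ^ 2 * ‖Qh q‖ ^ 2 * ∑ k : Fin d → Fin n, 1 / DeltaXir n 0 (shiftr n k (sOf M q)) ^ 2) := (one_mul _).symm
      _ ≤ ((d * Real.pi ^ 4 / 4) * Delta1r 0 (sOf M q) * ∑ k : Fin d → Fin n, 1 / DeltaXir n 0 (shiftr n k (sOf M q)) ^ 2)
            * (r ^ 2 * ‖Qh q‖ ^ 2 * ∑ k : Fin d → Fin n, 1 / DeltaXir n 0 (shiftr n k (sOf M q)) ^ 2) :=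
          mul_le_mul_of_nonneg_right hfib hT0
      _ = (d * Real.pi ^ 4 / 4) * ((n : ℝ) ^ d * r ^ 2)
            * (Delta1r 0 (sOf M q) * (r ^ 2 * ‖Qh q‖ ^ 2 * (∑ k : Fin d → Fin n, 1 / DeltaXir n 0 (shiftr n k (sOf M q)) ^ 2) ^ 2)) := by
          rw [hrn]; ring
      _ = (d * Real.pi ^ 4 / 4) * (n : ℝ) ^ d
            * (Delta1r 0 (sOf M q) * (r ^ 2 * r ^ 2 * ‖Qh q‖ ^ 2 * (∑ k : Fin d → Fin n, 1 / DeltaXir n 0 (shiftr n k (sOf M q)) ^ 2) ^ 2)) := by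
          ring

end Main

end Summit.QuantumFields.YangMills.Theorems.Prop7CentreHarmonicDivFlat
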